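import Mathlib
import HarnessLib
import Summits.Ventures.LatticeQCDFlow.Exactness.U1SubstepForceChainRule
import Summits.Ventures.LatticeQCDFlow.Exactness.U1FTHMCErgodic

/-!
# `U(1)` rung: the exact (autodiff) force of the BOOKED LOG-JACOBIAN of one masked Wilson-flow sub-step, in closed form

HONEST FRAMING: exact (Metropolis-corrected) sampling algorithms for lattice gauge theory;
figures of merit are autocorrelation/cost numbers at stated couplings and volumes; no
continuum-physics claim.

Venture `LatticeQCDFlow` (cell pub-lqcd), topic `Exactness`; FANOUT row 14 (`eng-flowhmc`, engine
`latflow.fthmc`, family B, `U(1)` rung; the FT-HMC force is `κ · fderiv (p ↦ S̃(e^(icp)·V)) 0 (δ_e)`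
with `S̃ = S∘F − log J`).  NEW WORK of the cell over this row's `U1DriftPlaquetteCalculus` /
`U1SubstepForceChainRule` (derivative of the booked factor `C_e` along the drift, its value on a
basis vector `−c·N_e(V)(e')`) and GEN-9's `U1FTHMCErgodic` (`abs_u1WilsonFlowLOFactorSum_le`:
`|C_e| ≤ 2(d−1)`); nothing is cited as a fact; no number.  The booked factor of the sub-step
`(μ, b)` is VERBATIM as in `exists_layers_u1WilsonFlowLO`: `J(V) = ∏_(a active) (1 − ε C_a(V))`,
`C_a = Σ_(ν ≠ μ) [Re P(x;μ,ν) + Re P(x−ν̂;μ,ν)]`.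

* `u1Factor_pos` — `1 − ε C_e(W) > 0` at every field once `2(d−1)|ε| < 1` (the refusal rule X-8);
* `hasFDerivAt_log_u1Jacobian_circleDrift` — `p ↦ log J(e^(icp)·V)` is Fréchet differentiable at
  `0` with derivative `Σ_a (1 − ε C_a(V))⁻¹ • (−(ε • DC_a))`;
* **`u1ExactForce_logJacobian`** —
  `κ · fderiv (p ↦ log J(e^(icp)·V)) 0 (δ_e') = κcε · Σ_(a active) N_a(V)(e') / (1 − ε C_a(V))`,
  `N_a(V)(e') = Σ_ν [Im P(V;x,μ,ν)·ℓ_(x,μ,ν)(δ_e') + Im P(V;x−ν̂,μ,ν)·ℓ_(x−ν̂,μ,ν)(δ_e')]` the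
  incidence-weighted sum over the `2(d−1)` plaquettes through `a = (x, μ)`.

NOT CLAIMED: bounds (`U1SubstepForceBounds`); `SU(2)`; floating point; any number.
-/

noncomputable section

namespace Summit.Ventures.LatticeQCDFlow.Exactness

open Literature.MathematicalPhysics.QuantumFieldTheory
open scoped BigOperators

variable {d L : ℕ} {X : Type*} [DecidableEq X] (χ : Site d L → X)

/-! ## The exact force of the booked log-Jacobian -/

section LogJ

variable [NeZero L]

omit [NeZero L] in
/-- Every booked factor `1 − ε C_e(W)` is positive when `2(d−1)|ε| < 1`. -/
theorem u1Factor_pos {ε : ℝ} (hε : |ε| * (2 * ((d - 1 : ℕ) : ℝ)) < 1) (W : GaugeConfig d L Circle)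
    (e : Edge d L) :
    0 < 1 - ε * ∑ ν ∈ Finset.univ.erase e.2,
      (((plaquetteHolonomy W e.1 e.2 ν : Circle) : ℂ).re +
        ((plaquetteHolonomy W (e.1 - Pi.single ν 1) e.2 ν : Circle) : ℂ).re) := by
  have hC := abs_u1WilsonFlowLOFactorSum_le W e
  have h1 : |ε * ∑ ν ∈ Finset.univ.erase e.2,
      (((plaquetteHolonomy W e.1 e.2 ν : Circle) : ℂ).re +
        ((plaquetteHolonomy W (e.1 - Pi.single ν 1) e.2 ν : Circle) : ℂ).re)| < 1 := by
    rw [abs_mul]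
    exact (mul_le_mul_of_nonneg_left hC (abs_nonneg ε)).trans_lt hε
  linarith [(abs_lt.mp h1).2]

/-- **`p ↦ log J(e^(icp)·V)` is Fréchet differentiable at `0`**, with derivative
`Σ_(a active) (1 − ε C_a(V))⁻¹ • (−(ε • DC_a))` (`2(d−1)|ε| < 1`). -/
theorem hasFDerivAt_log_u1Jacobian_circleDrift (μ : Fin d) (b : X) {ε : ℝ}
    (hε : |ε| * (2 * ((d - 1 : ℕ) : ℝ)) < 1) (c : ℝ) (V : GaugeConfig d L Circle) :
    HasFDerivAt (fun p : Edge d L → ℝ => Real.log ((fun V : GaugeConfig d L Circle =>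
        ∏ a : {e : Edge d L // e.2 = μ ∧ χ e.1 = b},
          (1 - ε * ∑ ν ∈ Finset.univ.erase a.1.2,
            (((plaquetteHolonomy V a.1.1 a.1.2 ν : Circle) : ℂ).re +
              ((plaquetteHolonomy V (a.1.1 - Pi.single ν 1) a.1.2 ν : Circle) : ℂ).re)))
        ((fun i : Edge d L => Circle.exp (c * p i)) * V)))
      (∑ a : {e : Edge d L // e.2 = μ ∧ χ e.1 = b},
        (1 - ε * ∑ ν ∈ Finset.univ.erase a.1.2,
            (((plaquetteHolonomy V a.1.1 a.1.2 ν : Circle) : ℂ).re +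
              ((plaquetteHolonomy V (a.1.1 - Pi.single ν 1) a.1.2 ν : Circle) : ℂ).re))⁻¹ •
        -(ε • ∑ ν ∈ Finset.univ.erase a.1.2,
          ((-(c * ((plaquetteHolonomy V a.1.1 a.1.2 ν : Circle) : ℂ).im)) •
            (ContinuousLinearMap.proj (R := ℝ) (φ := fun _ : Edge d L => ℝ) (a.1.1, a.1.2) +
              ContinuousLinearMap.proj (R := ℝ) (φ := fun _ : Edge d L => ℝ) (a.1.1.shift a.1.2, ν) -
              ContinuousLinearMap.proj (R := ℝ) (φ := fun _ : Edge d L => ℝ) (a.1.1.shift ν, a.1.2) -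
              ContinuousLinearMap.proj (R := ℝ) (φ := fun _ : Edge d L => ℝ) (a.1.1, ν)) +
          (-(c * ((plaquetteHolonomy V (a.1.1 - Pi.single ν 1) a.1.2 ν : Circle) : ℂ).im)) •
            (ContinuousLinearMap.proj (R := ℝ) (φ := fun _ : Edge d L => ℝ) (a.1.1 - Pi.single ν 1, a.1.2) +
              ContinuousLinearMap.proj (R := ℝ) (φ := fun _ : Edge d L => ℝ) ((a.1.1 - Pi.single ν 1).shift a.1.2, ν) -
              ContinuousLinearMap.proj (R := ℝ) (φ := fun _ : Edge d L => ℝ) ((a.1.1 - Pi.single ν 1).shift ν, a.1.2) -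
              ContinuousLinearMap.proj (R := ℝ) (φ := fun _ : Edge d L => ℝ) (a.1.1 - Pi.single ν 1, ν))))) 0 := by
  have hpos := u1Factor_pos (d := d) (L := L) hε
  -- the log of the product is the sum of the logs
  have hlog : (fun p : Edge d L → ℝ => Real.log ((fun V : GaugeConfig d L Circle =>
        ∏ a : {e : Edge d L // e.2 = μ ∧ χ e.1 = b},
          (1 - ε * ∑ ν ∈ Finset.univ.erase a.1.2,
            (((plaquetteHolonomy V a.1.1 a.1.2 ν : Circle) : ℂ).re +
              ((plaquetteHolonomy V (a.1.1 - Pi.single ν 1) a.1.2 ν : Circle) : ℂ).re)))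
        ((fun i : Edge d L => Circle.exp (c * p i)) * V))) =
      fun p : Edge d L → ℝ => ∑ a : {e : Edge d L // e.2 = μ ∧ χ e.1 = b},
        Real.log (1 - ε * ∑ ν ∈ Finset.univ.erase a.1.2,
            (((plaquetteHolonomy ((fun i : Edge d L => Circle.exp (c * p i)) * V) a.1.1 a.1.2 ν : Circle) : ℂ).re +
              ((plaquetteHolonomy ((fun i : Edge d L => Circle.exp (c * p i)) * V) (a.1.1 - Pi.single ν 1) a.1.2 ν : Circle) : ℂ).re)) := by
    funext p
    exact Real.log_prod (s := Finset.univ) (fun a _ => (hpos _ a.1).ne')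
  rw [hlog]
  refine HasFDerivAt.fun_sum fun a _ => ?_
  have h2 := ((hasFDerivAt_u1Factor_circleDrift c V a.1).const_mul ε).const_sub (1 : ℝ)
  have hx : (1 : ℝ) - ε * ∑ ν ∈ Finset.univ.erase a.1.2,
      (((plaquetteHolonomy ((fun i : Edge d L => Circle.exp (c * (0 : Edge d L → ℝ) i)) * V) a.1.1 a.1.2 ν : Circle) : ℂ).re +
        ((plaquetteHolonomy ((fun i : Edge d L => Circle.exp (c * (0 : Edge d L → ℝ) i)) * V) (a.1.1 - Pi.single ν 1) a.1.2 ν : Circle) : ℂ).re) ≠ 0 := by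
    rw [circleDrift_zero]
    exact (hpos V a.1).ne'
  have h3 := h2.log hx
  refine h3.congr_fderiv ?_
  rw [circleDrift_zero]

/-- **`κ · fderiv (p ↦ log J(e^(icp)·V)) 0 (δ_e') = κcε · Σ_(a active) N_a(V)(e') / (1 − ε C_a(V))`**
for `2(d−1)|ε| < 1` (every booked factor is positive; `J = ∏_active (1 − ε C_a)` VERBATIM as packaged). -/
theorem u1ExactForce_logJacobian (μ : Fin d) (b : X) {ε : ℝ} (hε : |ε| * (2 * ((d - 1 : ℕ) : ℝ)) < 1)
    (c κ : ℝ) (V : GaugeConfig d L Circle) (e' : Edge d L) :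
    κ * fderiv ℝ (fun p : Edge d L → ℝ => Real.log ((fun V : GaugeConfig d L Circle =>
        ∏ a : {e : Edge d L // e.2 = μ ∧ χ e.1 = b},
          (1 - ε * ∑ ν ∈ Finset.univ.erase a.1.2,
            (((plaquetteHolonomy V a.1.1 a.1.2 ν : Circle) : ℂ).re +
              ((plaquetteHolonomy V (a.1.1 - Pi.single ν 1) a.1.2 ν : Circle) : ℂ).re)))
        ((fun i : Edge d L => Circle.exp (c * p i)) * V))) 0 (Pi.single e' 1) =
      κ * (c * (ε * ∑ a : {e : Edge d L // e.2 = μ ∧ χ e.1 = b},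
        (∑ ν ∈ Finset.univ.erase a.1.2,
          (((plaquetteHolonomy V a.1.1 a.1.2 ν : Circle) : ℂ).im *
              ((Pi.single e' (1 : ℝ) : Edge d L → ℝ) (a.1.1, a.1.2) +
                (Pi.single e' (1 : ℝ) : Edge d L → ℝ) (a.1.1.shift a.1.2, ν) -
                (Pi.single e' (1 : ℝ) : Edge d L → ℝ) (a.1.1.shift ν, a.1.2) -
                (Pi.single e' (1 : ℝ) : Edge d L → ℝ) (a.1.1, ν)) +
            ((plaquetteHolonomy V (a.1.1 - Pi.single ν 1) a.1.2 ν : Circle) : ℂ).im *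
              ((Pi.single e' (1 : ℝ) : Edge d L → ℝ) (a.1.1 - Pi.single ν 1, a.1.2) +
                (Pi.single e' (1 : ℝ) : Edge d L → ℝ) ((a.1.1 - Pi.single ν 1).shift a.1.2, ν) -
                (Pi.single e' (1 : ℝ) : Edge d L → ℝ) ((a.1.1 - Pi.single ν 1).shift ν, a.1.2) -
                (Pi.single e' (1 : ℝ) : Edge d L → ℝ) (a.1.1 - Pi.single ν 1, ν)))) /
        (1 - ε * ∑ ν ∈ Finset.univ.erase a.1.2,
            (((plaquetteHolonomy V a.1.1 a.1.2 ν : Circle) : ℂ).re +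
              ((plaquetteHolonomy V (a.1.1 - Pi.single ν 1) a.1.2 ν : Circle) : ℂ).re)))) := by
  have hpos := u1Factor_pos (d := d) (L := L) hε
  rw [(hasFDerivAt_log_u1Jacobian_circleDrift χ μ b hε c V).fderiv]
  -- evaluate on the basis vector
  simp only [sum_apply, Finset.mul_sum]
  refine Finset.sum_congr rfl fun a _ => ?_
  rw [smul_apply, neg_apply, smul_apply, u1FactorDeriv_apply_single, smul_eq_mul, smul_eq_mul]
  have hne := (hpos V a.1).ne'
  field_simp

end LogJ

end Summit.Ventures.LatticeQCDFlow.Exactness
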